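import Summits.BirchSwinnertonDyer.BirchSwinnertonDyer.Theorems.AlignedTransportAtTwoMainConjectureOfRankZeroBSDAtTwoSeedTwoTorsionCrux
import HarnessLib

/-! # RESTATEMENT option C2ˢ (att-p3 g7) — crux C2 stmt-BirchSwinnertonDyer-22298, an addendum to RESTATEMENT-KIT.md (att-p4 g0)

C2ˢ = C2 + ONE extra binder, the `μ₂ = 0 ∧ torsion` certificate spelled in 2-DESCENT currency and with NO `X5.O1` vocabulary:
«for every cyclotomic datum `(κ, γ)`, `{s ∈ Sel_{2^∞}(W/ℚ_∞^κ) | 2·s = 0}` is finite». By PART XVI (p618827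
`…SeedTwoTorsion.towerGapAtTwo_iff_finite_selmer_twoTorsion`) this binder is EQUIVALENT to C2′'s `X5.O1.TowerGapAtTwo W`, so C2ˢ and C2′
are the same item up to a kernel `Iff`; the closer below is p619138 `…SeedTwoTorsionCrux.mazurMainConjecture_two_of_bsdp_of_finite_selmer_twoTorsion`,
conditional on the same five PRINT facts as every closer in the kit (prefix them as hypotheses for an unconditional close, kit §C2′ / lead A10).
Nothing here is registered; this file only certifies that the displayed text elaborates and closes (rc 0, 0 sorry). BSD is not proved. -/

set_option linter.dupNamespace false

noncomputable section

open scoped Classical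
open CongruenceSubgroup WeierstrassCurve Literature.NumberTheory.EllipticCurves
  Literature.NumberTheory.EllipticCurves.ModularForms Literature.NumberTheory.EllipticCurves.Greenberg1999
  Summit.BirchSwinnertonDyer.Rank1Residual.X1.MuLambda Summit.BirchSwinnertonDyer.Rank1Residual.F1Sign2
  Summit.BirchSwinnertonDyer.BirchSwinnertonDyer.Theorems.Rank1ResidualX1Defs
  Summit.BirchSwinnertonDyer.BirchSwinnertonDyer.Theorems.AlignedTransportAtTwoSeedTwoTorsion

namespace Summit.BirchSwinnertonDyer.BirchSwinnertonDyer.Cruxes.MainConjectureOfRankZeroBSDAtTwo.Probe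

/-- C2ˢ — C2 + ONE extra binder in 2-descent currency (route-independent spelling of C2′'s `TowerGapAtTwo W`). -/
def MainConjectureOfRankZeroBSDAtTwoS : Prop :=
  ∀ (W : WeierstrassCurve ℚ) [W.IsElliptic] [W.IsGloballyMinimal], ¬ W.HasCM →
    Literature.NumberTheory.EllipticCurves.IsOrdinaryAt W 2 →
    (∀ x : ℚ, ¬ Literature.NumberTheory.EllipticCurves.Greenberg1999.HasRationalTwoTorsionX W x) → ¬ IsSquare W.Δ →
    W.analyticRank = 0 →
    (∀ ⦃N : ℕ⦄ [NeZero N] (f : CuspForm (CongruenceSubgroup.Gamma0 N) 2),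
      Literature.NumberTheory.EllipticCurves.ModularForms.IsNewformOf W f →
      ∀ G : Literature.NumberTheory.EllipticCurves.IwasawaAlgebra 2,
        Summit.BirchSwinnertonDyer.Rank1Residual.F1Sign2.IsEvenBranchLiftAtTwo W f G →
        Summit.BirchSwinnertonDyer.Rank1Residual.X1.MuLambda.red G ≠ 0) →
    Literature.NumberTheory.EllipticCurves.BSDp W 2 →
    (∀ (κ : Literature.NumberTheory.EllipticCurves.ZpExtension ℚ 2) (γ : Field.absoluteGaloisGroup ℚ), κ.IsCyclotomic →
      κ.IsTopGenerator γ → Literature.NumberTheory.EllipticCurves.IsCyclotomicVariable 2 γ →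
      Set.Finite {s : W.selmerInfty κ | 2 • s = 0}) →
    Summit.BirchSwinnertonDyer.BirchSwinnertonDyer.Theorems.Rank1ResidualX1Defs.MazurMainConjecture W 2

/-- The closer of C2ˢ modulo the five PRINT facts. -/
theorem mainConjectureOfRankZeroBSDAtTwoS_certified
    (h17 : ∀ (V : WeierstrassCurve ℚ) [V.IsElliptic] [V.IsGloballyMinimal] [NeZero (V.conductorNorm ℤ)]
      (f : CuspForm (Gamma0 (V.conductorNorm ℤ)) 2), kato_divisibility_allPrimes V 2 (f := f))
    (hGr : Greenberg1999.thm41_charValue_rankZero_anyPrime)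
    (hper : realPeriodRat_eq_unit_mul_plusPeriod_two) (hmod : nonempty_modularParametrizationData)
    (hGZK : rank_eq_analyticRank_of_analyticRank_le_one) : MainConjectureOfRankZeroBSDAtTwoS :=
  fun W _ _ _ hord ht _ hr _ hbsd hfin =>
    mazurMainConjecture_two_of_bsdp_of_finite_selmer_twoTorsion W (fun f => h17 W f) hGr hper hmod hGZK hord ht hr hbsd hfin

end Summit.BirchSwinnertonDyer.BirchSwinnertonDyer.Cruxes.MainConjectureOfRankZeroBSDAtTwo.Probe

end
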